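import Summits.HodgeConjecture.HodgeConjecture.Theorems.MarkmanPartnerTransportPicardThreeK3SquaresKugaSatakeBiquadratic
import Summits.HodgeConjecture.HodgeConjecture.Theorems.MarkmanPartnerTransportPicardThreeK3SquaresSemiregularSeed
import Summits.HodgeConjecture.HodgeConjecture.Theorems.MarkmanPartnerTransportPicardThreeK3SquaresVarescoK3SimilitudeHolds

/-!
# Route MarkmanPartnerTransport · crux `PicardThreeK3Squares` (stmt-HodgeConjecture-19652) —
# the Kuga–Satake branches of the crux WITHOUT the hypothesis `hVar` (Varesco's theorem now proved)

With `KugaSatakePair.varesco2023_transcendentalHodgeSimilitude_algebraic_of_kugaSatake_K3_holds`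
(`…VarescoK3SimilitudeHolds`: the named fact `Surfaces.Varesco2023_transcendentalHodgeSimilitude_algebraic_of_kugaSatake_K3`
PROVED in the tree) every by-name theorem of the crux-#4 chain that took the fact as a hypothesis `hVar`
loses it. Gen 14 had already re-proved the self-similitude endpoints (`…KugaSatakeSimilitudeVarescoFree`,
`…KugaSatakeResidueVarescoFree`); this file discharges `hVar` in the three remaining by-name statements by
direct instantiation (no new mathematics):

* `picardThreeK3Squares_of_kugaSatake_of_generation_and_oneCycle'` — **the crux BY NAME from Buskin,
  markings, the Kuga–Satake statement on the real-quadratic surfaces (`3 ≤ ρ ≤ 16`), (GEN) at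
  `ρ ∈ {4, 6, 10}` and (ONE) at `ρ ∈ {7, 13}`** (`…KugaSatakeResidue`, `hVar` removed);
* `picardThreeK3Squares_of_kugaSatake_of_semiregularSeeds'` — the same with the (GEN)/(ONE) inputs replaced
  by SEMIREGULAR SEED packages and Bloch's theorem (`…SemiregularSeed`, `hVar` removed);
* `hodgeConjectureFor_square_of_two_selfSimilitudes_of_kugaSatake'` — **HC⁴(S × S) when `End_Hdg T(S)` is
  generated by the sum of two rational Hodge self-similitudes (the biquadratic cells), granted Kuga–Satake for
  `S` ONLY** (`…KugaSatakeBiquadratic`, `hVar` removed).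

CONDITIONAL on the displayed hypotheses (Kuga–Satake statements, Buskin's theorem, markings, Bloch's
semiregularity, the (GEN)/(ONE)/seed clauses — open in print where so marked in the parent files); no
definition, no new named fact, no sorry; nothing here says HC or the crux is proved. Prover seat
hodge-nonav-19652-p1 (gen 15), `--supports stmt-HodgeConjecture-19652`.

References: M. Varesco, Math. Z. 305 (2023), Thm. 5.3; N. Buskin, J. reine angew. Math. 755 (2019), Thm. 1.1;
van Geemen–Schütt, Forum Math. Sigma 13 (2025), Thm. 1.1 and §4.8; S. Bloch, Invent. Math. 17 (1972), Thm. 7.3.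
-/

set_option linter.dupNamespace false

noncomputable section

namespace Summit.HodgeConjecture.HodgeConjecture.Theorems.MarkmanPartnerTransport.KugaSatakeSimilitude

open Module CategoryTheory MonoidalCategory CartesianMonoidalCategory AlgebraicGeometry
open Literature.AlgebraicGeometry Literature.AlgebraicGeometry.Motives Literature.AlgebraicGeometry.HodgeTheory
open Literature.AlgebraicGeometry.Hyperkaehler Literature.AlgebraicGeometry.Surfaces
open Literature.AlgebraicTopology.SingularHomology
open Summit.HodgeConjecture.HodgeConjecture.Theorems
open Summit.HodgeConjecture.HodgeConjecture.Theorems.NikulinTwinTransport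
open Summit.HodgeConjecture.HodgeConjecture.Theorems.MarkmanPartnerTransport
open Summit.HodgeConjecture.HodgeConjecture.Theses.MarkmanPartnerTransport

variable {S : SchemeOver ℂ} {η : complexBetti S (2 * 1) ≃ₗ[ℂ] (K3Index → ℂ)} {p : complexBetti S (2 * 2)}
  {x : K3Index → ℂ}

/-- `MarkedK3[S, η, p, x]`: VERBATIM the `let MarkedK3 := …` binder of the route declaration
`PicardThreeK3Squares`. Local notation only. -/
local notation3 (prettyPrint := false) "MarkedK3[" S ", " η ", " p ", " x "]" =>
  (p ≠ 0 ∧ (IsIntegralClass p ∧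
    (∀ q : complexBetti S (2 * 2), IsIntegralClass q → ∃ n : ℤ, q = n • p) ∧
    (∀ c : complexBetti S (2 * 1), IsIntegralClass c ↔ ∃ v : K3Index → ℤ, η c = fun i => (v i : ℂ)) ∧
    (∀ a b : complexBetti S (2 * 1),
      cupProduct (rfl : 2 * 1 + 2 * 1 = 2 * 2) a b = k3Form (η a) (η b) • p) ∧
    IsOfHodgeType 2 S (2 * 1) 2 0 (LinearEquiv.symm η x) ∧
    (∀ τ : complexBetti S (2 * 1), IsOfHodgeType 2 S (2 * 1) 2 0 τ →
      ∃ t : ℂ, τ = t • LinearEquiv.symm η x)) ∧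
    (k3Form x x = 0 ∧ 0 < (k3Form (star x) x).re ∧
      ∃ u : K3Index → ℤ, k3Form (fun i => (u i : ℂ)) x = 0 ∧ 0 < ∑ i, ∑ j, u i * k3Gram i j * u j))

/-- `Corr[hS ; γ, y] = fst_*(snd^* y ∪ γ)` on `H²(S(ℂ); ℂ)`, complex orientations. Local notation only. -/
local notation3 (prettyPrint := false) "Corr[" hS " ; " γ ", " y "]" =>
  complexGysin complexOrientationFamily (IsSmoothProjective.tensor_holds hS hS) hS
    (SemiCartesianMonoidalCategory.fst _ _) (rfl : 2 * 1 + 2 * 2 + 2 * 2 = 2 * 1 + 2 * (2 + 2))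
    (cupProduct (rfl : 2 * 1 + 2 * 2 = 2 * 1 + 2 * 2)
      (complexBetti.map (SemiCartesianMonoidalCategory.snd _ _) (2 * 1) y) γ)

/-- `Res[f, s, k, A] = A|_{𝒳_s}` (VERBATIM `…SemiregularSeed`). Local notation only. -/
local notation3 (prettyPrint := false) "Res[" f ", " s ", " k ", " A "]" =>
  complexBetti.map (Motives.fiberι f s) k A

/-- `SRSeed[S ; γ]`: a semiregular seed package for `γ` (VERBATIM `…SemiregularSeed`). Local notation only. -/
local notation3 (prettyPrint := false) "SRSeed[" S " ; " γ "]" =>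
  (∃ (X₀ : SchemeOver ℂ) (Z : Scheme.{0}) (i : Z ⟶ X₀.left) (x : complexBetti X₀ (2 * 2))
    (𝒳 B : SchemeOver ℂ) (f : 𝒳 ⟶ B) (s₀ t₁ : ComplexPoints B) (e₀ : X₀ ≅ fiberOver f s₀)
    (e₁ : S ⊗ S ≅ fiberOver f t₁) (W : complexBetti 𝒳 (2 * 2)),
    IsClosedImmersion i ∧ IsRegularImmersionOfCodim i 2 ∧ AlgebraicGeometry.IsIntegral Z ∧
    (∀ z ∈ Set.range i.base, (2 : ℕ∞) ≤ Order.coheight z) ∧ IsBlochSemiregular i 4 2 ∧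
    x ∈ classesSupportedOn X₀ (Set.range i.base) (2 * 2) ∧
    IsSmoothProjectiveFamily f 4 ∧ IsQuasiProjectiveOver 𝒳 ∧ IsQuasiProjectiveOver B ∧
    AlgebraicGeometry.Smooth B.hom ∧ ConnectedSpace (ComplexPoints B) ∧
    (∀ s : ComplexPoints B, IsRationalClass (Res[f, s, 2 * 2, W]) ∧
      IsOfHodgeType 4 (fiberOver f s) (2 * 2) 2 2 (Res[f, s, 2 * 2, W])) ∧
    complexBetti.map e₀.hom (2 * 2) (Res[f, s₀, 2 * 2, W]) = x ∧
    complexBetti.map e₁.hom (2 * 2) (Res[f, t₁, 2 * 2, W]) - γ ∈ algebraicClasses (S ⊗ S) 2)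

/-- `Transc[S, y]`: `y` is cup-orthogonal to `N¹(S)`. Local notation only. -/
local notation3 (prettyPrint := false) "Transc[" S ", " y "]" =>
  (∀ d ∈ algebraicClasses S 1, cupProduct (rfl : 2 * 1 + 2 * 1 = 2 * 2) y d = 0)

/-- `Scalar[S]`: «`End_Hdg T(S) = ℚ`» (VERBATIM `…KugaSatakeResidue`). Local notation only. -/
local notation3 (prettyPrint := false) "Scalar[" S "]" =>
  (∀ (f : complexBetti S (2 * 1) →ₗ[ℂ] complexBetti S (2 * 1)),
    (∀ y, IsRationalClass y → IsRationalClass (f y)) →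
    (∀ (i j : ℕ) y, IsOfHodgeType 2 S (2 * 1) i j y → IsOfHodgeType 2 S (2 * 1) i j (f y)) →
    (∀ d ∈ algebraicClasses S 1, f d = 0) →
    (∀ y : complexBetti S (2 * 1), ∀ d ∈ algebraicClasses S 1,
      cupProduct (rfl : 2 * 1 + 2 * 1 = 2 * 2) (f y) d = 0) →
    ∃ a : ℚ, ∀ y : complexBetti S (2 * 1),
      (∀ d ∈ algebraicClasses S 1, cupProduct (rfl : 2 * 1 + 2 * 1 = 2 * 2) y d = 0) →
        f y = (a : ℂ) • y)

/-- `QuadGen[S]`: a real-quadratic generator (VERBATIM `…KugaSatakeResidue`). Local notation only. -/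
local notation3 (prettyPrint := false) "QuadGen[" S "]" =>
  (∃ (ψ : complexBetti S (2 * 1) →ₗ[ℂ] complexBetti S (2 * 1)) (d : ℚ), d ≠ 0 ∧
    (∀ y, IsRationalClass y → IsRationalClass (ψ y)) ∧
    (∀ (i j : ℕ) y, IsOfHodgeType 2 S (2 * 1) i j y → IsOfHodgeType 2 S (2 * 1) i j (ψ y)) ∧
    (∀ d' ∈ algebraicClasses S 1, ψ d' = 0) ∧
    (∀ y : complexBetti S (2 * 1), Transc[S, ψ y]) ∧
    (∀ y w : complexBetti S (2 * 1),
      cupProduct (rfl : 2 * 1 + 2 * 1 = 2 * 2) (ψ y) w = cupProduct (rfl : 2 * 1 + 2 * 1 = 2 * 2) y (ψ w)) ∧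
    (∀ y : complexBetti S (2 * 1), Transc[S, y] → ψ (ψ y) = (d : ℂ) • y) ∧
    TranscendentalEndomorphismsGeneratedBy S ψ)

/-- `GenCycle[S, hS]` (VERBATIM `…KugaSatakeResidue`). Local notation only. -/
local notation3 (prettyPrint := false) "GenCycle[" S ", " hS "]" =>
  (∃ e : complexBetti S (2 * 1) →ₗ[ℂ] complexBetti S (2 * 1),
    (∀ y, IsRationalClass y → IsRationalClass (e y)) ∧
    (∀ (i j : ℕ) y, IsOfHodgeType 2 S (2 * 1) i j y → IsOfHodgeType 2 S (2 * 1) i j (e y)) ∧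
    (∃ γ ∈ algebraicClasses (S ⊗ S) 2, ∀ y : complexBetti S (2 * 1),
      e y = Corr[IsK3Surface.isSmoothProjective hS ; γ, y]) ∧
    TranscendentalEndomorphismsGeneratedBy S e)

/-- `IrrCycle[S, hS]` (VERBATIM `…KugaSatakeResidue`). Local notation only. -/
local notation3 (prettyPrint := false) "IrrCycle[" S ", " hS "]" =>
  (∃ e : complexBetti S (2 * 1) →ₗ[ℂ] complexBetti S (2 * 1),
    (∀ y, IsRationalClass y → IsRationalClass (e y)) ∧
    (∀ (i j : ℕ) y, IsOfHodgeType 2 S (2 * 1) i j y → IsOfHodgeType 2 S (2 * 1) i j (e y)) ∧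
    (∃ γ ∈ algebraicClasses (S ⊗ S) 2, ∀ y : complexBetti S (2 * 1),
      e y = Corr[IsK3Surface.isSmoothProjective hS ; γ, y]) ∧
    (∃ (σ₀ : complexBetti S (2 * 1)) (ev : ℂ), IsOfHodgeType 2 S (2 * 1) 2 0 σ₀ ∧ σ₀ ≠ 0 ∧
      e σ₀ = ev • σ₀ ∧ ∀ a : ℚ, (a : ℂ) ≠ ev))

/-- `GenSeed[S, hS]` (VERBATIM `…SemiregularSeed`). Local notation only. -/
local notation3 (prettyPrint := false) "GenSeed[" S ", " hS "]" =>
  (∃ (e : complexBetti S (2 * 1) →ₗ[ℂ] complexBetti S (2 * 1)) (γ : complexBetti (S ⊗ S) (2 * 2)),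
    (∀ y, IsRationalClass y → IsRationalClass (e y)) ∧
    (∀ (i j : ℕ) y, IsOfHodgeType 2 S (2 * 1) i j y → IsOfHodgeType 2 S (2 * 1) i j (e y)) ∧
    (∀ y : complexBetti S (2 * 1), e y = Corr[IsK3Surface.isSmoothProjective hS ; γ, y]) ∧
    SRSeed[S ; γ] ∧ TranscendentalEndomorphismsGeneratedBy S e)

/-- `IrrSeed[S, hS]` (VERBATIM `…SemiregularSeed`). Local notation only. -/
local notation3 (prettyPrint := false) "IrrSeed[" S ", " hS "]" =>
  (∃ (e : complexBetti S (2 * 1) →ₗ[ℂ] complexBetti S (2 * 1)) (γ : complexBetti (S ⊗ S) (2 * 2)),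
    (∀ y, IsRationalClass y → IsRationalClass (e y)) ∧
    (∀ (i j : ℕ) y, IsOfHodgeType 2 S (2 * 1) i j y → IsOfHodgeType 2 S (2 * 1) i j (e y)) ∧
    (∀ y : complexBetti S (2 * 1), e y = Corr[IsK3Surface.isSmoothProjective hS ; γ, y]) ∧
    SRSeed[S ; γ] ∧
    (∃ (σ₀ : complexBetti S (2 * 1)) (ev : ℂ), IsOfHodgeType 2 S (2 * 1) 2 0 σ₀ ∧ σ₀ ≠ 0 ∧
      e σ₀ = ev • σ₀ ∧ ∀ a : ℚ, (a : ℂ) ≠ ev))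

/-! ### The crux BY NAME, granted Kuga–Satake on the real-quadratic surfaces, without `hVar` -/

/-- **`PicardThreeK3Squares` BY NAME — the residue modulo Kuga–Satake on the real-quadratic surfaces
(`…KugaSatakeResidue.picardThreeK3Squares_of_kugaSatake_of_generation_and_oneCycle`) WITHOUT Varesco's
theorem as a hypothesis**: granted Buskin's Thm. 1.1, markings, the Kuga–Satake statement for the non-CM
projective K3 surfaces with `3 ≤ ρ(S) ≤ 16` and a real-quadratic generator, (GEN) at `ρ ∈ {4, 6, 10}` and
(ONE) at `ρ ∈ {7, 13}`, the crux holds. CONDITIONAL; credits nothing to HC.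
[cite: Varesco2023, Thm. 5.3] [cite: Buskin2019, Thm. 1.1] [cite: GeemenSchutt2023, Thm. 1.1, §4.8 and Rem. 4.9] -/
theorem picardThreeK3Squares_of_kugaSatake_of_generation_and_oneCycle' (hB : Buskin2019_hodgeIsometry_algebraic)
    (hmark : Huybrechts_K3_marking_exists)
    (hKS : ∀ (S : SchemeOver ℂ) (hS : IsK3Surface S), ¬ HasComplexMultiplication S →
      3 ≤ Module.finrank ℂ ↥(algebraicClasses S 1) → Module.finrank ℂ ↥(algebraicClasses S 1) ≤ 16 →
      QuadGen[S] → IsKSCorrespondenceAlgebraicBetti hS.isSmoothProjective)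
    (hGen : ∀ (S : SchemeOver ℂ) (hS : IsK3Surface S), ¬ HasComplexMultiplication S →
      (Module.finrank ℂ ↥(algebraicClasses S 1) = 4 ∨ Module.finrank ℂ ↥(algebraicClasses S 1) = 6 ∨
        Module.finrank ℂ ↥(algebraicClasses S 1) = 10) → ¬ Scalar[S] → ¬ QuadGen[S] → GenCycle[S, hS])
    (hOne : ∀ (S : SchemeOver ℂ) (hS : IsK3Surface S), ¬ HasComplexMultiplication S →
      (Module.finrank ℂ ↥(algebraicClasses S 1) = 7 ∨ Module.finrank ℂ ↥(algebraicClasses S 1) = 13) →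
      ¬ Scalar[S] → ¬ QuadGen[S] → IrrCycle[S, hS]) :
    PicardThreeK3Squares :=
  picardThreeK3Squares_of_kugaSatake_of_generation_and_oneCycle hB hmark
    KugaSatakePair.varesco2023_transcendentalHodgeSimilitude_algebraic_of_kugaSatake_K3_holds hKS hGen hOne

/-- **`PicardThreeK3Squares` BY NAME from Kuga–Satake on the real-quadratic surfaces and SEMIREGULAR SEEDS
(`…SemiregularSeed.picardThreeK3Squares_of_kugaSatake_of_semiregularSeeds`) WITHOUT Varesco's theorem as a
hypothesis.** CONDITIONAL (Kuga–Satake, Buskin, markings, Bloch's semiregularity theorem, seed packages);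
credits nothing to HC. [cite: Varesco2023, Thm. 5.3] [cite: BuchweitzFlenner2003, Thm. 5.2] [cite: Buskin2019, Thm. 1.1] -/
theorem picardThreeK3Squares_of_kugaSatake_of_semiregularSeeds' (hB : Buskin2019_hodgeIsometry_algebraic)
    (hmark : Huybrechts_K3_marking_exists)
    (hKS : ∀ (S : SchemeOver ℂ) (hS : IsK3Surface S), ¬ HasComplexMultiplication S →
      3 ≤ Module.finrank ℂ ↥(algebraicClasses S 1) → Module.finrank ℂ ↥(algebraicClasses S 1) ≤ 16 →
      QuadGen[S] → IsKSCorrespondenceAlgebraicBetti hS.isSmoothProjective)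
    (hBl : BlochSemiregularSpread 4 2)
    (hGenSR : ∀ (S : SchemeOver ℂ) (hS : IsK3Surface S), ¬ HasComplexMultiplication S →
      (Module.finrank ℂ ↥(algebraicClasses S 1) = 4 ∨ Module.finrank ℂ ↥(algebraicClasses S 1) = 6 ∨
        Module.finrank ℂ ↥(algebraicClasses S 1) = 10) → ¬ Scalar[S] → ¬ QuadGen[S] → GenSeed[S, hS])
    (hOneSR : ∀ (S : SchemeOver ℂ) (hS : IsK3Surface S), ¬ HasComplexMultiplication S →
      (Module.finrank ℂ ↥(algebraicClasses S 1) = 7 ∨ Module.finrank ℂ ↥(algebraicClasses S 1) = 13) →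
      ¬ Scalar[S] → ¬ QuadGen[S] → IrrSeed[S, hS]) :
    PicardThreeK3Squares :=
  SemiregularSeed.picardThreeK3Squares_of_kugaSatake_of_semiregularSeeds hB hmark
    KugaSatakePair.varesco2023_transcendentalHodgeSimilitude_algebraic_of_kugaSatake_K3_holds hKS hBl hGenSR hOneSR

/-! ### The biquadratic cells, granted Kuga–Satake only -/

/-- **HC⁴(S × S) when `End_Hdg T(S)` is generated by the sum of TWO rational Hodge self-similitudes, granted
Kuga–Satake for `S` ONLY** (`…KugaSatakeBiquadratic.hodgeConjectureFor_square_of_two_selfSimilitudes_of_kugaSatake`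
with `hVar` removed). CONDITIONAL on the Kuga–Satake hypothesis; credits nothing to HC.
[cite: Varesco2023, Thm. 5.3 and Conj. 4.2] [cite: GeemenSchutt2023, §2.1 and §4.8] -/
theorem hodgeConjectureFor_square_of_two_selfSimilitudes_of_kugaSatake'
    (hS : IsK3Surface S) (hM : MarkedK3[S, η, p, x])
    (hKS : IsKSCorrespondenceAlgebraicBetti hS.isSmoothProjective)
    (ψ₁ ψ₂ : complexBetti S (2 * 1) →ₗ[ℂ] complexBetti S (2 * 1))
    (h1₁ : ∀ y, IsRationalClass y → IsRationalClass (ψ₁ y))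
    (h2₁ : ∀ (i j : ℕ) y, IsOfHodgeType 2 S (2 * 1) i j y → IsOfHodgeType 2 S (2 * 1) i j (ψ₁ y))
    (h3₁ : ∀ d ∈ algebraicClasses S 1, ψ₁ d = 0)
    (h4₁ : ∀ y : complexBetti S (2 * 1), Transc[S, ψ₁ y])
    (h5₁ : ∀ y w : complexBetti S (2 * 1),
      cupProduct (rfl : 2 * 1 + 2 * 1 = 2 * 2) (ψ₁ y) w = cupProduct (rfl : 2 * 1 + 2 * 1 = 2 * 2) y (ψ₁ w))
    (d₁ : ℚ) (hd₁ : d₁ ≠ 0) (hψψ₁ : ∀ y : complexBetti S (2 * 1), Transc[S, y] → ψ₁ (ψ₁ y) = (d₁ : ℂ) • y)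
    (h1₂ : ∀ y, IsRationalClass y → IsRationalClass (ψ₂ y))
    (h2₂ : ∀ (i j : ℕ) y, IsOfHodgeType 2 S (2 * 1) i j y → IsOfHodgeType 2 S (2 * 1) i j (ψ₂ y))
    (h3₂ : ∀ d ∈ algebraicClasses S 1, ψ₂ d = 0)
    (h4₂ : ∀ y : complexBetti S (2 * 1), Transc[S, ψ₂ y])
    (h5₂ : ∀ y w : complexBetti S (2 * 1),
      cupProduct (rfl : 2 * 1 + 2 * 1 = 2 * 2) (ψ₂ y) w = cupProduct (rfl : 2 * 1 + 2 * 1 = 2 * 2) y (ψ₂ w))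
    (d₂ : ℚ) (hd₂ : d₂ ≠ 0) (hψψ₂ : ∀ y : complexBetti S (2 * 1), Transc[S, y] → ψ₂ (ψ₂ y) = (d₂ : ℂ) • y)
    (hgen : TranscendentalEndomorphismsGeneratedBy S (ψ₁ + ψ₂)) :
    HodgeConjectureFor 4 (S ⊗ S) :=
  hodgeConjectureFor_square_of_two_selfSimilitudes_of_kugaSatake
    KugaSatakePair.varesco2023_transcendentalHodgeSimilitude_algebraic_of_kugaSatake_K3_holds hS hM hKS ψ₁ ψ₂
    h1₁ h2₁ h3₁ h4₁ h5₁ d₁ hd₁ hψψ₁ h1₂ h2₂ h3₂ h4₂ h5₂ d₂ hd₂ hψψ₂ hgen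

end Summit.HodgeConjecture.HodgeConjecture.Theorems.MarkmanPartnerTransport.KugaSatakeSimilitude

end
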